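import Summits.BirchSwinnertonDyer.BirchSwinnertonDyer.Theorems.GenusKolyvaginAtTwoPowDvdShaCardAtTwoPosTBottomRungSocketTransposition
import Summits.BirchSwinnertonDyer.BirchSwinnertonDyer.Theorems.GenusKolyvaginAtTwoPowDvdShaCardAtTwoPosTBottomRungTransverseValueTransposition
import HarnessLib

/-!
# Route `GenusKolyvaginAtTwo`, crux L⁺_T `PowDvdShaCardAtTwoPosT` (stmt-BirchSwinnertonDyer-23379), road «E4⁺», socket hbot⁺ (LEAD R10″) —
# LAYER 11: THE (V44)-SOCKET `hTr⁺` DISCHARGED AT TRANSPOSITION-DEEP PRIMES, and the socket `hbot⁺` with `hTr⁺` GONE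
# (gk2-p2 g22's contract 02:40Z / 03:35Z: VERBATIM the `hbot` binder of `pow_dvd_natCard_sha_of_sockets_of_rank_le_one_transposition`)

Seat `bsd-line-gk2-p4` g24 (WIDTH-5 attach, cell `bsd-f1-sign2`), `--supports stmt-BirchSwinnertonDyer-23379 --as helper`.
THEOREMS ONLY (no definition, no named fact, no `sorry`).  BSD is NOT proved by any of this; L⁺_T / Q4_T are NOT claimed; nothing is closed.

WHAT.  gk2-p3 g24's `…RTBottomRungTransverseSocket` §2–§3 at transposition-deep primes, ANY SIGN of `Δ`:
* `hTr_of_three_le_transposition'` — gk2-p5 g32's `hTr_of_three_le_transposition` (p759413, proved independently with the same argument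
  as this seat's draft) in VERBATIM the shape of the hypothesis `hTr` of layer 10's `RelaxedCount.hbot_socket_margin(_onHabitat)_transposition`
  (the transposition slot at `ℓ` read off the product hypothesis), for every `L ≥ 3`: for a ℚ-class `Z` over `E[4]` descending the level-`4` Kolyvagin class `c₂(n′)` of a square-free product `n′` of
  transposition-deep Zhang–Kolyvagin primes of index `≥ 2`, an own prime `ℓ ∣ n′` of index `≥ L ≥ 3`, ANY prime `𝔓 ∣ ℓ` of `\bar ℤ` and ANY
  arithmetic Frobenius `F` at `𝔓`: `[2•Z, F] = F•P₁ − P₁` for some `P₁ ∈ E[4]`.  The complex conjugation `c₀` of the `Δ < 0` proof is replaced by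
  `F` ITSELF: `F² = 1` on `E[4]` and `F` moves a point of `E[2]` (gk2-p2 g22 `PlusDescent.frob_involutive_and_moves_twoTorsion_of_transposition`),
  so `E[4] = ℤP₀ ⊕ ℤ·FP₀` freely over `ℤ/4` (sibling route's `OffBigImageOddLocalAtTwo.Engine.exists_regular_generator_of_smul_twoTorsion_ne`), and
  LEAD g18's reduction `RelaxedCount.exists_h1Eval_two_nsmul_eq_smul_sub_of_sq` (stated for any pair `F = c₀` on `E[4]`, here `c₀ := F`) +
  `two_zsmul_h1Eval_sq_eq_zero_of_resTorsion` + the sign-free K-side `TransverseValue.h1Eval_kolyvaginClass_eq_zero_of_absGaloisRestrict_eq_sq`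
  (Howard 2.7.3 at `τ_{F²} ∈ Γ_K`, squares of `Γ_ℚ` restrict from `Γ_K`) finish exactly as on `Δ < 0`;
* `exists_deep_primitive_of_gross_witness_of_three_le_transposition`, **`hbot_socket_margin_of_three_le_transposition`**,
  **`hbot_socket_margin_onHabitat_of_three_le_transposition`** — layer 9's closure and layer 10's two sockets with `hTr⁺` discharged
  (extra binder `3 ≤ L` / `3 ≤ L + k`, free at `L = 2(M₀+6)`).  With `L := 2(M₀+6)`, `k := 1`, `G q := L + 1 ≤ idx q ∧ TRANSP q`,
  `hG := fun q _ hidx hF ↦ ⟨hidx, hF⟩` the last is the `hbot` binder of gk2-p2's `pow_dvd_natCard_sha_of_sockets_of_rank_le_one_transposition`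
  from the item's witness `P(n₀) ∉ 2E(K[n₀])`; displayed residual: Q2 `KolyvaginRelationAtTwo` only.

HONEST FRAMING.  Ports of the `Δ < 0` bottom rung; closes nothing; BSD is not proved.

References: [McCallumLMS1991] §4 Prop. 4.4 (1), §5 proof of Prop. 5.2 (13), Lemma 5.3; [Howard2004HeegnerKolyvagin] Lemma 2.7.3;
[GrossLMS1991] §3 (3.1)–(3.3), §9; [Kolyvagin1991MathAnn] Thm. 2.2; [SilvermanAEC2009] Cor. III.6.4(b).
-/

set_option autoImplicit false
-- the Theorems namespace of this sub repeats the summit name by design (D-0017 nested layout)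
set_option linter.dupNamespace false

noncomputable section

open scoped Classical Pointwise

open WeierstrassCurve NumberField IsDedekindDomain Field
open Literature.NumberTheory.EllipticCurves Literature.NumberTheory.GaloisRepresentations
open Literature.NumberTheory.GaloisCohomology
open Literature.NumberTheory.EllipticCurves.ModularForms
open Summit.BirchSwinnertonDyer.Rank1Residual
open Summit.BirchSwinnertonDyer.BirchSwinnertonDyer.Theses.GenusKolyvaginAtTwo (KolyvaginRelationAtTwo)

namespace Summit.BirchSwinnertonDyer.BirchSwinnertonDyer.Theorems.GenusExact.TransverseValue

section Socket

variable {K : Type} [Field K] [NumberField K] (W : WeierstrassCurve ℚ) [W.IsElliptic] [W.IsGloballyMinimal]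
  [NeZero (W.conductorNorm ℤ)]

/-- **§2 THE (V44)-SOCKET `hTr⁺` IN LAYER 10's BINDER SHAPE** — gk2-p5 g32's `hTr_of_three_le_transposition` (p759413: at a transposition-deep
own prime `ℓ ∣ n′` of index `≥ L ≥ 3`, for ANY prime `𝔓 ∣ ℓ` and ANY arithmetic Frobenius `F` at `𝔓`, `[2•Z, F] = F•P₁ − P₁`; proof: `F² = 1` on
`E[4]` and `F` moves a point of `E[2]`, regular frame `E[4] = ℤP₀ ⊕ ℤ·FP₀`, LEAD's reduction with `c₀ := F`, Howard 2.7.3 on the K-side) with the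
transposition slot at `ℓ` read off the product hypothesis `hn'K ℓ hℓ` — VERBATIM the hypothesis `hTr` of layer 10's
`RelaxedCount.hbot_socket_margin_transposition` / `…_onHabitat_transposition` / layer 9's closure.
[cite: McCallumLMS1991, §4 Prop. 4.4 (1), §5 proof of Prop. 5.2 (13)] [cite: Howard2004HeegnerKolyvagin, Lemma 2.7.3] [cite: GrossLMS1991, §3 (3.1)–(3.3), §9] -/
theorem hTr_of_three_le_transposition' (hK : IsImaginaryQuadratic K) (hodd : Odd (NumberField.discr K))
    (h3 : NumberField.discr K ≠ -3) (Dt : ModularParametrizationData W (W.conductorNorm ℤ)) (β : ℤ) (ι : K →+* ℂ)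
    [∀ j : ℕ, NumberField (ringClassField K ι j)] {L : ℕ} (hL : 3 ≤ L) :
    ∀ (n' : ℕ) (d' : KolyvaginHeegnerData Dt β ι n') (Z : galoisCohomology (W.torsionGaloisModule ((2 ^ 2 : ℕ) : ℤ)) 1),
      Squarefree n' →
      (∀ q ∈ n'.primeFactors, Zhang2014.IsKolyvaginPrime (W.conductorNorm ℤ) W K 2 q ∧ 2 ≤ Zhang2014.kolyvaginIndex W 2 q ∧
        (∃ (v : HeightOneSpectrum (𝓞 ℚ)) (𝔓 : Ideal (absIntegers (𝓞 ℚ) ℚ)) (h : absoluteGaloisGroup ℚ),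
          (q : 𝓞 ℚ) ∈ v.asIdeal ∧ 𝔓 ∈ v.primesAbove ∧ IsArithFrobAt (𝓞 ℚ) h 𝔓 ∧ ∃ u : geomTorsion W 2, h • u ≠ u)) →
      resTorsion W K ((2 ^ 2 : ℕ) : ℤ) Z = d'.kolyvaginClass Nat.prime_two 2 →
      ∀ (v : HeightOneSpectrum (𝓞 ℚ)) (ℓ : ℕ), ℓ ∈ n'.primeFactors → (ℓ : 𝓞 ℚ) ∈ v.asIdeal →
        L ≤ Zhang2014.kolyvaginIndex W 2 ℓ →
        ∀ 𝔓 ∈ v.primesAbove, ∀ F : absoluteGaloisGroup ℚ, IsArithFrobAt (𝓞 ℚ) F 𝔓 →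
          ∃ P₁ : geomTorsion W ((2 ^ 2 : ℕ) : ℤ), h1Eval W _ ((2 : ℕ) • Z) F = F • P₁ - P₁ :=
  fun n' d' Z hn' hn'K hZ v ℓ hℓ hℓv hLℓ 𝔓 h𝔓 F hF ↦
    hTr_of_three_le_transposition W hK hodd h3 Dt β ι hL n' d' Z hn' hn'K hZ v ℓ hℓ hℓv hLℓ (hn'K ℓ hℓ).2.2 𝔓 h𝔓 F hF

/-- **§3 THE BOTTOM-RUNG CLOSURE AT TRANSPOSITION-DEEP PRIMES WITH `hTr⁺` DISCHARGED**: layer 9's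
`RelaxedCount.exists_deep_primitive_of_gross_witness_transposition'` (all-deep primitive product from a level-`4` transposition-deep witness, either
parity; any sign of `Δ`) for every `L ≥ 3`, modulo (NPh_L^{2N}) and Q2 only.
[cite: McCallumLMS1991, §5 proof of Prop. 5.2, p. 285] [cite: Kolyvagin1991MathAnn, Thm. 2.2] [cite: Howard2004HeegnerKolyvagin, Lemma 2.7.3] -/
theorem exists_deep_primitive_of_gross_witness_of_three_le_transposition (hQ2 : KolyvaginRelationAtTwo) (hcm : ¬ W.HasCM)
    (hT : Odd W.tamagawaProduct) (hρ : ∀ m : ℕ, W.HasSurjectiveModNGaloisRep (2 ^ m : ℕ))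
    (hK : IsImaginaryQuadratic K) (hodd : Odd (NumberField.discr K)) (h3 : NumberField.discr K ≠ -3)
    (hHe : SatisfiesHeegnerHypothesis (W.conductorNorm ℤ) K)
    (Dt : ModularParametrizationData W (W.conductorNorm ℤ)) (β : ℤ) (ι : K →+* ℂ)
    [∀ j : ℕ, NumberField (ringClassField K ι j)] {L : ℕ} (hL3 : 3 ≤ L)
    (hNPh : ∀ z : galH1Torsion (W.baseChange K) ((2 ^ L : ℕ) : ℤ),
      (∀ ρ' ∈ torsionFixing (W.baseChange K) ((2 ^ L : ℕ) : ℤ), h1Eval (W.baseChange K) ((2 ^ L : ℕ) : ℤ) z ρ' = 0) →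
      (∀ w : HeightOneSpectrum (𝓞 K), ((2 * W.conductorNorm ℤ : ℕ) : 𝓞 K) ∈ w.asIdeal →
        z ∈ selmerLocalKer (W.baseChange K) (w.adicCompletion K) ((2 ^ L : ℕ) : ℤ)) → z = 0)
    {n₀ : ℕ} (hn₀ : Squarefree n₀)
    (hn₀K : ∀ q ∈ n₀.primeFactors, Zhang2014.IsKolyvaginPrime (W.conductorNorm ℤ) W K 2 q ∧ 2 ≤ Zhang2014.kolyvaginIndex W 2 q ∧
      (∃ (v : HeightOneSpectrum (𝓞 ℚ)) (𝔓 : Ideal (absIntegers (𝓞 ℚ) ℚ)) (h : absoluteGaloisGroup ℚ),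
        (q : 𝓞 ℚ) ∈ v.asIdeal ∧ 𝔓 ∈ v.primesAbove ∧ IsArithFrobAt (𝓞 ℚ) h 𝔓 ∧ ∃ u : geomTorsion W 2, h • u ≠ u))
    (e₀ : KolyvaginHeegnerData Dt β ι n₀) (he₀ : addOrderOf (e₀.kolyvaginClass Nat.prime_two 2) = 2 ^ 2) :
    ∃ (n : ℕ) (e : KolyvaginHeegnerData Dt β ι n), Squarefree n ∧
      (n.primeFactors.card = n₀.primeFactors.card ∨ n.primeFactors.card = n₀.primeFactors.card + 1) ∧
      (∀ q ∈ n.primeFactors, Zhang2014.IsKolyvaginPrime (W.conductorNorm ℤ) W K 2 q ∧ L ≤ Zhang2014.kolyvaginIndex W 2 q ∧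
        (∃ (v : HeightOneSpectrum (𝓞 ℚ)) (𝔓 : Ideal (absIntegers (𝓞 ℚ) ℚ)) (h : absoluteGaloisGroup ℚ),
          (q : 𝓞 ℚ) ∈ v.asIdeal ∧ 𝔓 ∈ v.primesAbove ∧ IsArithFrobAt (𝓞 ℚ) h 𝔓 ∧ ∃ u : geomTorsion W 2, h • u ≠ u)) ∧
      addOrderOf (e.kolyvaginClass Nat.prime_two 2) = 2 ^ 2 :=
  RelaxedCount.exists_deep_primitive_of_gross_witness_transposition' W hQ2 hcm hT hρ hK hodd h3 hHe Dt β ι (by omega) hNPh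
    (hTr_of_three_le_transposition' W hK hodd h3 Dt β ι hL3) hn₀ hn₀K e₀ he₀

/-- **§3 THE SOCKET `hbot⁺` OF THE KS⁺ ASSEMBLY, margin-`k` class, WITH `hTr⁺` DISCHARGED — any sign of `Δ`**: layer 10's
`RelaxedCount.hbot_socket_margin_transposition` composed with `hTr_of_three_le_transposition` at level parameter `L + k` (so `3 ≤ L + k` is
asked — free for the KS⁺ assembly, `L = 2(M₀+6)`).  For every prime predicate `G` implied by `Zhang q ∧ L + k ≤ idx q ∧ TRANSP q`:
`∃ n d, Squarefree n ∧ (∀ q ∣ n, (Zhang q ∧ L ≤ idx q) ∧ G q) ∧ addOrderOf c_L(d) = 2^L`.  Displayed residuals: Q2 `KolyvaginRelationAtTwo` and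
(NPh_{L+k}^{2N}) only. [cite: McCallumLMS1991, §5 proof of Prop. 5.2, p. 285] [cite: Kolyvagin1991MathAnn, Thm. 2.2]
[cite: Howard2004HeegnerKolyvagin, Lemma 2.7.3] -/
theorem hbot_socket_margin_of_three_le_transposition (hQ2 : KolyvaginRelationAtTwo) (hcm : ¬ W.HasCM)
    (hT : Odd W.tamagawaProduct) (hρ : ∀ m : ℕ, W.HasSurjectiveModNGaloisRep (2 ^ m : ℕ))
    (hK : IsImaginaryQuadratic K) (hodd : Odd (NumberField.discr K)) (h3 : NumberField.discr K ≠ -3)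
    (hHe : SatisfiesHeegnerHypothesis (W.conductorNorm ℤ) K)
    (Dt : ModularParametrizationData W (W.conductorNorm ℤ)) (β : ℤ) (ι : K →+* ℂ)
    [∀ j : ℕ, NumberField (ringClassField K ι j)] {L : ℕ} (hL2 : 2 ≤ L) (k : ℕ) (hLk : 3 ≤ L + k)
    (hNPh : ∀ z : galH1Torsion (W.baseChange K) ((2 ^ (L + k) : ℕ) : ℤ),
      (∀ ρ' ∈ torsionFixing (W.baseChange K) ((2 ^ (L + k) : ℕ) : ℤ), h1Eval (W.baseChange K) ((2 ^ (L + k) : ℕ) : ℤ) z ρ' = 0) →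
      (∀ w : HeightOneSpectrum (𝓞 K), ((2 * W.conductorNorm ℤ : ℕ) : 𝓞 K) ∈ w.asIdeal →
        z ∈ selmerLocalKer (W.baseChange K) (w.adicCompletion K) ((2 ^ (L + k) : ℕ) : ℤ)) → z = 0)
    (G : ℕ → Prop)
    (hG : ∀ q : ℕ, Zhang2014.IsKolyvaginPrime (W.conductorNorm ℤ) W K 2 q → L + k ≤ Zhang2014.kolyvaginIndex W 2 q →
      (∃ (v : HeightOneSpectrum (𝓞 ℚ)) (𝔓 : Ideal (absIntegers (𝓞 ℚ) ℚ)) (h : absoluteGaloisGroup ℚ),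
        (q : 𝓞 ℚ) ∈ v.asIdeal ∧ 𝔓 ∈ v.primesAbove ∧ IsArithFrobAt (𝓞 ℚ) h 𝔓 ∧ ∃ u : geomTorsion W 2, h • u ≠ u) → G q)
    {n₀ : ℕ} (hn₀ : Squarefree n₀)
    (hn₀K : ∀ q ∈ n₀.primeFactors, Zhang2014.IsKolyvaginPrime (W.conductorNorm ℤ) W K 2 q ∧ 2 ≤ Zhang2014.kolyvaginIndex W 2 q ∧
      (∃ (v : HeightOneSpectrum (𝓞 ℚ)) (𝔓 : Ideal (absIntegers (𝓞 ℚ) ℚ)) (h : absoluteGaloisGroup ℚ),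
        (q : 𝓞 ℚ) ∈ v.asIdeal ∧ 𝔓 ∈ v.primesAbove ∧ IsArithFrobAt (𝓞 ℚ) h 𝔓 ∧ ∃ u : geomTorsion W 2, h • u ≠ u))
    (e₀ : KolyvaginHeegnerData Dt β ι n₀) (he₀ : addOrderOf (e₀.kolyvaginClass Nat.prime_two 2) = 2 ^ 2) :
    ∃ (n : ℕ) (d : KolyvaginHeegnerData Dt β ι n), Squarefree n ∧
      (∀ q ∈ n.primeFactors, (Zhang2014.IsKolyvaginPrime (W.conductorNorm ℤ) W K 2 q ∧ L ≤ Zhang2014.kolyvaginIndex W 2 q) ∧ G q) ∧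
      addOrderOf (d.kolyvaginClass Nat.prime_two L) = 2 ^ L :=
  RelaxedCount.hbot_socket_margin_transposition W hQ2 hcm hT hρ hK hodd h3 hHe Dt β ι hL2 k hNPh
    (hTr_of_three_le_transposition' W hK hodd h3 Dt β ι hLk) G hG hn₀ hn₀K e₀ he₀

/-- **§3 THE SOCKET `hbot⁺`, margin-`k` class, ON THE CUT HABITAT, WITH `hTr⁺` DISCHARGED — any sign of `Δ`** (gk2-p2 g22's contract: with
`L := 2(M₀+6)`, `k := 1`, `G q := L + 1 ≤ idx q ∧ TRANSP q`, `hG := fun q _ hidx hF ↦ ⟨hidx, hF⟩` this is VERBATIM the binder `hbot` of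
`PlusDescent.pow_dvd_natCard_sha_of_sockets_of_rank_le_one_transposition`): layer 10's `RelaxedCount.hbot_socket_margin_onHabitat_transposition`
(«∃ odd place `v ∣ N` of multiplicative reduction» + the two non-squares of the frame discharge (NPh) by
`NonPhantomPow.nonPhantomAtTwo_of_hasMultiplicativeReductionAt`; witness `P(n₀) ∉ 2E(K[n₀])` at transposition-deep Zhang–Kolyvagin primes of
index `≥ 2`) composed with `hTr_of_three_le_transposition`.  Displayed residual: Q2 only.
[cite: McCallumLMS1991, §5 Prop. 5.2 and its proof, p. 285] [cite: GrossLMS1991, §3 (3.1)–(3.3)] -/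
theorem hbot_socket_margin_onHabitat_of_three_le_transposition (hQ2 : KolyvaginRelationAtTwo) (hcm : ¬ W.HasCM)
    (hT : Odd W.tamagawaProduct) (hρ : ∀ m : ℕ, W.HasSurjectiveModNGaloisRep (2 ^ m : ℕ))
    (hK : IsImaginaryQuadratic K) (hodd : Odd (NumberField.discr K)) (h3 : NumberField.discr K ≠ -3)
    (hHe : SatisfiesHeegnerHypothesis (W.conductorNorm ℤ) K) (hns : ¬ IsSquare ((NumberField.discr K : ℚ) * -|W.Δ|))
    (hns₂ : ¬ IsSquare ((NumberField.discr K : ℚ) * (-(2 * |W.Δ|))))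
    {v : HeightOneSpectrum (𝓞 ℚ)} (h2v : ((2 : ℕ) : 𝓞 ℚ) ∉ v.asIdeal) (hNv : ((W.conductorNorm ℤ : ℕ) : 𝓞 ℚ) ∈ v.asIdeal)
    (hmult : W.HasMultiplicativeReductionAt v)
    (Dt : ModularParametrizationData W (W.conductorNorm ℤ)) (β : ℤ) (ι : K →+* ℂ)
    [∀ j : ℕ, NumberField (ringClassField K ι j)] {L : ℕ} (hL2 : 2 ≤ L) (k : ℕ) (hLk : 3 ≤ L + k)
    (G : ℕ → Prop)
    (hG : ∀ q : ℕ, Zhang2014.IsKolyvaginPrime (W.conductorNorm ℤ) W K 2 q → L + k ≤ Zhang2014.kolyvaginIndex W 2 q →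
      (∃ (v : HeightOneSpectrum (𝓞 ℚ)) (𝔓 : Ideal (absIntegers (𝓞 ℚ) ℚ)) (h : absoluteGaloisGroup ℚ),
        (q : 𝓞 ℚ) ∈ v.asIdeal ∧ 𝔓 ∈ v.primesAbove ∧ IsArithFrobAt (𝓞 ℚ) h 𝔓 ∧ ∃ u : geomTorsion W 2, h • u ≠ u) → G q)
    {n₀ : ℕ} (hn₀ : Squarefree n₀)
    (hn₀K : ∀ q ∈ n₀.primeFactors, Zhang2014.IsKolyvaginPrime (W.conductorNorm ℤ) W K 2 q ∧ 2 ≤ Zhang2014.kolyvaginIndex W 2 q ∧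
      (∃ (v : HeightOneSpectrum (𝓞 ℚ)) (𝔓 : Ideal (absIntegers (𝓞 ℚ) ℚ)) (h : absoluteGaloisGroup ℚ),
        (q : 𝓞 ℚ) ∈ v.asIdeal ∧ 𝔓 ∈ v.primesAbove ∧ IsArithFrobAt (𝓞 ℚ) h 𝔓 ∧ ∃ u : geomTorsion W 2, h • u ≠ u))
    (e₀ : KolyvaginHeegnerData Dt β ι n₀)
    (he₀ : ¬ ∃ Q : (W.baseChange (ringClassField K ι n₀)).toAffine.Point, (2 : ℤ) • Q = e₀.derivedPoint) :
    ∃ (n : ℕ) (d : KolyvaginHeegnerData Dt β ι n), Squarefree n ∧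
      (∀ q ∈ n.primeFactors, (Zhang2014.IsKolyvaginPrime (W.conductorNorm ℤ) W K 2 q ∧ L ≤ Zhang2014.kolyvaginIndex W 2 q) ∧ G q) ∧
      addOrderOf (d.kolyvaginClass Nat.prime_two L) = 2 ^ L :=
  RelaxedCount.hbot_socket_margin_onHabitat_transposition W hQ2 hcm hT hρ hK hodd h3 hHe hns hns₂ h2v hNv hmult Dt β ι hL2 k
    (hTr_of_three_le_transposition' W hK hodd h3 Dt β ι hLk) G hG hn₀ hn₀K e₀ he₀

end Socket

end Summit.BirchSwinnertonDyer.BirchSwinnertonDyer.Theorems.GenusExact.TransverseValue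

end
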